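import Summits.QuantumFields.YangMills.Theorems.UnitScaleTiltProp8HalvingQuarterMatrix
import HarnessLib

/-!
# Route `UnitScaleTilt`, crux K1 child «MinimiserStabilityRegPr» (stmt-QuantumFields-19200), registered stub V2′ `stub_halvingStep`
# (skeletons v8 5b4e846794b80374 / v10 `BirthV10`) — **THE P2 LETTERS OF `G̃` FOR `𝔤`-VALUED CURRENTS, WITHOUT COMPONENT LOSS**: the kernel extension
# `𝒢f(b) = Σ_{b′} (G̃e_{b′})(b)·f(b′)` of the real P2 operator `G̃` (`FlatCubeOpsText.GtSupLetterG`: «current size `β` ⇒ size `B₀β`», the `hG`∕`hN` shape of the F4 pen's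
# `FlatSmallSolution158CubeSeq.letter_solution158_dom_le`) satisfies the SAME weighted sup and gradient letters on matrix-valued currents — the two first-order letters
# of the `(165)-A₁` clause of the interior package (`HalvingAssemblyInterior`) for `A₁ = −𝒢W(A₁ + HB)` ([Balaban1985Variational] (158)) then follow from F4 + P3b by name

Cell `ym3-torus` (HUMAN RULING D-0037, YM ladder rung R3 — continuum SU(2) YM₃ on the torus is a RUNG, not the Clay problem), width seat
`ym-ust-19200-w3` gen 2 (D-0149).  `--supports stmt-QuantumFields-19200 --as helper`; def-free, 0 sorry, standard axioms.  Same lossless device as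
`HalvingQuarterMatrix` (p593496): every norm-dominated real reading `g` of the matrices commutes with the kernel extension (`g ∘ 𝒢f = G̃(g ∘ f)`), the real letter bounds
`g(𝒢f(b))` uniformly in `g`, and `‖M‖ = sup_g g(M)` (`HalvingQuarterMatrix.norm_le_of_forall_reFunctional`).

THE PRINT ([Balaban1985Variational] p. 304 (165)): *«|A|, |∇^ηA|, |∂^{η*}∂^ηA|, |Δ^ηA| < ¼M_Δmax{B₃ε₁, ½ε₀} + B₀C₄(36dL²B₁Mε₀)² + B₀4C₂(36dL²B₁Mε₀)²»* — the middle term is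
`|A₁| ≤ B₀·|W(A₁ + HB)|₍₋₃₎ ≤ B₀C₄ρ²` by (158) `A₁ = −G̃((δ/δA′)V)(A₁ + HB)`, the bound `|G̃f| ≤ B₀|f|₍₋₃₎` of [Balaban1984PropagatorsII] Prop. 2.2 (2.47)–(2.51) and Prop. 4 (98).

WHAT THIS FILE PROVES (no definition, no sorry):
* §1 `reFunctional_kernel'` — for finite index types `ι`, `κ`, a real linear `T : (ι → ℝ) →ₗ (κ → ℝ)` and the kernel extension `𝒯B(k) = Σ_i (Te_i)(k)·B(i)` to matrix-valued
  `B`: every reading `g(M) = r·Re(u·f(M))` has `g(𝒯B(k)) = T(g ∘ B)(k)` (the index-generic form of `HalvingQuarterMatrix.reFunctional_kernel`).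
* §2 **`matrixGtSup`** — `GtSupLetterG F n K w G̃ B₀` with nonnegative weights and a matrix current `f` of weighted size `w₃(b)‖f(b)‖ ≤ β` give, for the kernel
  extension `𝒢f`: `w₁(b)‖𝒢f(b)‖ ≤ B₀β` and `w₂(b)·Lᵏ·‖𝒢f(⟨b₋ + e_ν, dir b⟩) − 𝒢f(b)‖ ≤ B₀β` at every fine bond — VERBATIM the real letter with `|·| ↦ ‖·‖`.
HONEST SCOPE: bookkeeping; the letter `GtSupLetterG` is P2's (✓ `FlatPortBodyL0.body_of_adm22` for odd `L ≥ 5` on big tori), Prop. 4 is P3b's (★w5 p596336), the solution of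
(158) is F4's.  NOT a claim about the crux, the rung, or the mass gap.

References: T. Bałaban, CMP **102** (1985) 277–309 [Balaban1985Variational] (158) p.302, (165) p.304, Prop. 4 (98) p.293; CMP **96** (1984) 223–250
[Balaban1984PropagatorsII] Prop. 2.2 (2.47)–(2.51) p.231.
-/

set_option autoImplicit false

noncomputable section

open scoped BigOperators Matrix.Norms.L2Operator

namespace Summit.QuantumFields.YangMills.Theorems.HalvingGtMatrix

open Literature.MathematicalPhysics.QuantumFieldTheory.Balaban1983to89
open T3ContinuumYM3Torus (T3Family)
open FlatCubeOpsText (GtSupLetterG)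
open HalvingQuarterMatrix (norm_le_of_forall_reFunctional)

/-! ## §1 Readings commute with kernel extensions (index-generic) -/

section Kernel

variable {ι κ : Type*} [Fintype ι] [DecidableEq ι]

/-- **`g(𝒯B(k)) = T(g ∘ B)(k)`** for the kernel extension `𝒯B(k) = Σ_i (Te_i)(k)·B(i)` of a real linear `T` to matrix-valued data and the reading
`g(M) = r·Re(u·f(M))` (linearity of `T` on `X = Σ_i X(i)e_i`). [cite: Balaban1985Variational, (158) p.302] -/
theorem reFunctional_kernel' (T : (ι → ℝ) →ₗ[ℝ] (κ → ℝ)) {B : ι → Matrix (Fin 2) (Fin 2) ℂ} {𝔄 : κ → Matrix (Fin 2) (Fin 2) ℂ}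
    (h𝔄 : ∀ k, 𝔄 k = ∑ i, T (Pi.single i 1) k • B i) (f : StrongDual ℂ (Matrix (Fin 2) (Fin 2) ℂ)) (u : ℂ) (r : ℝ) (k : κ) :
    r * (u * f (𝔄 k)).re = T (fun i => r * (u * f (B i)).re) k := by
  have hX : (fun i => r * (u * f (B i)).re) = ∑ i, (r * (u * f (B i)).re) • (Pi.single i (1 : ℝ) : ι → ℝ) := by
    funext i'
    rw [Finset.sum_apply, Finset.sum_eq_single i' (fun i _ hi => by simp [Ne.symm hi]) (fun h => absurd (Finset.mem_univ _) h)]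
    simp
  have hR : T (fun i => r * (u * f (B i)).re) k = ∑ i, (r * (u * f (B i)).re) * T (Pi.single i 1) k := by
    rw [hX, map_sum, Finset.sum_apply]
    refine Finset.sum_congr rfl fun i _ => ?_
    rw [LinearMap.map_smul, Pi.smul_apply, smul_eq_mul]
  have hL : f (𝔄 k) = ∑ i, ((T (Pi.single i 1) k : ℝ) : ℂ) * f (B i) := by
    rw [h𝔄 k, map_sum]
    refine Finset.sum_congr rfl fun i _ => ?_
    rw [ContinuousLinearMap.map_smul_of_tower, Complex.real_smul]
  rw [hR, hL, Finset.mul_sum, Complex.re_sum, Finset.mul_sum]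
  refine Finset.sum_congr rfl fun i _ => ?_
  rw [mul_left_comm u, Complex.re_ofReal_mul]
  ring

end Kernel

/-! ## §2 The `G̃` letters for matrix-valued currents -/

section Gt

variable {F : T3Family} {n K : ℕ}

/-- **THE WEIGHTED SUP AND GRADIENT LETTERS OF `G̃` FOR A `𝔤`-VALUED CURRENT** (`GtSupLetterG` with `|·| ↦ ‖·‖`): for nonnegative weights, `0 ≤ β`, a matrix current with
`w₃(b)‖f(b)‖ ≤ β` and the kernel extension `𝒢f(b) = Σ_{b′} (G̃e_{b′})(b)·f(b′)`: `w₁(b)‖𝒢f(b)‖ ≤ B₀β` and `w₂(b)Lᵏ‖𝒢f(⟨b₋ + e_ν, dir b⟩) − 𝒢f(b)‖ ≤ B₀β`.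
[cite: Balaban1985Variational, (158) p.302, (165) p.304; Balaban1984PropagatorsII, Prop. 2.2 (2.47)-(2.51) p.231] -/
theorem matrixGtSup {w : ℕ → PBond (F.P K) 0 → ℝ} {Gt : (PBond (F.P K) 0 → ℝ) →ₗ[ℝ] (PBond (F.P K) 0 → ℝ)} {B₀ β : ℝ}
    (hGt : GtSupLetterG F n K w Gt B₀) (hw0 : ∀ m b, 0 ≤ w m b) (hβ : 0 ≤ β)
    {f 𝒢 : PBond (F.P K) 0 → Matrix (Fin 2) (Fin 2) ℂ} (h𝒢 : ∀ b, 𝒢 b = ∑ b', Gt (Pi.single b' 1) b • f b')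
    (hf : ∀ b, w 3 b * ‖f b‖ ≤ β) :
    (∀ b, w 1 b * ‖𝒢 b‖ ≤ B₀ * β) ∧
    ∀ (b : PBond (F.P K) 0) (ν : Fin 3), w 2 b * (F.L : ℝ) ^ (K - n) * ‖𝒢 ⟨b.src.shift ν, b.dir⟩ - 𝒢 b‖ ≤ B₀ * β := by
  have hLk : (0 : ℝ) < (F.L : ℝ) ^ (K - n) := by
    have : (0 : ℝ) < (F.L : ℝ) := by exact_mod_cast lt_trans zero_lt_one F.hL.2
    positivity
  -- `0 ≤ B₀β` from the letter at the zero current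
  have hB₀β : 0 ≤ B₀ * β := by
    obtain ⟨b⟩ : Nonempty (PBond (F.P K) 0) := ⟨⟨fun _ => 0, ⟨0, lt_of_lt_of_le zero_lt_one (F.P K).hd⟩⟩⟩
    have h := (hGt 0 β hβ (fun b => by rw [Pi.zero_apply, abs_zero, mul_zero]; exact hβ)).1 b
    rwa [map_zero, Pi.zero_apply, abs_zero, mul_zero] at h
  -- the real letter for every norm-dominated reading of the current
  have key : ∀ (fd : StrongDual ℂ (Matrix (Fin 2) (Fin 2) ℂ)) (u : ℂ) (r : ℝ),
      (∀ y : Matrix (Fin 2) (Fin 2) ℂ, |r * (u * fd y).re| ≤ ‖y‖) →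
      (∀ b, w 1 b * |Gt (fun b' => r * (u * fd (f b')).re) b| ≤ B₀ * β) ∧
      ∀ (b : PBond (F.P K) 0) (ν : Fin 3),
        w 2 b * (F.L : ℝ) ^ (K - n) * |Gt (fun b' => r * (u * fd (f b')).re) ⟨b.src.shift ν, b.dir⟩ - Gt (fun b' => r * (u * fd (f b')).re) b| ≤ B₀ * β :=
    fun fd u r hg => hGt _ β hβ fun b' => (mul_le_mul_of_nonneg_left (hg (f b')) (hw0 3 b')).trans (hf b')
  refine ⟨fun b => ?_, fun b ν => ?_⟩
  · rcases (hw0 1 b).lt_or_eq with hpos | hzero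
    · rw [← le_div_iff₀' hpos]
      refine norm_le_of_forall_reFunctional (𝒢 b) (div_nonneg hB₀β hpos.le) fun fd u r hg => ?_
      rw [reFunctional_kernel' Gt h𝒢 fd u r b, le_div_iff₀' hpos]
      exact (mul_le_mul_of_nonneg_left (le_abs_self _) hpos.le).trans ((key fd u r hg).1 b)
    · rw [← hzero, zero_mul]; exact hB₀β
  · rcases (hw0 2 b).lt_or_eq with hpos | hzero
    · have hpos' : 0 < w 2 b * (F.L : ℝ) ^ (K - n) := mul_pos hpos hLk
      rw [← le_div_iff₀' hpos']
      refine norm_le_of_forall_reFunctional _ (div_nonneg hB₀β hpos'.le) fun fd u r hg => ?_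
      have hlin : r * (u * fd (𝒢 ⟨b.src.shift ν, b.dir⟩ - 𝒢 b)).re =
          Gt (fun b' => r * (u * fd (f b')).re) ⟨b.src.shift ν, b.dir⟩ - Gt (fun b' => r * (u * fd (f b')).re) b := by
        rw [map_sub, mul_sub, Complex.sub_re, mul_sub, reFunctional_kernel' Gt h𝒢 fd u r, reFunctional_kernel' Gt h𝒢 fd u r]
      rw [hlin, le_div_iff₀' hpos']
      exact (mul_le_mul_of_nonneg_left (le_abs_self _) hpos'.le).trans ((key fd u r hg).2 b ν)
    · rw [← hzero, zero_mul, zero_mul]; exact hB₀β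

end Gt

/-! ## Cite corrigendum (v1.1, append-only; lit g22 t6 2026-08-28T02:27:38Z)
In [Balaban1984PropagatorsII] (CMP **96**) only (2.47) is on p. 231; (2.48)–(2.51) are on p. 232.  The locators «Prop. 2.2 (2.47)–(2.51) p.231» in the docstrings above
should read «Prop. 2.2 (2.47) p.231, (2.48)–(2.51) p.232». [cite: Balaban1984PropagatorsII, Prop. 2.2 (2.47) p.231, (2.48)-(2.51) p.232] -/

end Summit.QuantumFields.YangMills.Theorems.HalvingGtMatrix

end
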